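import Literature.MathematicalPhysics.QuantumFieldTheory.Balaban1983to89.B11Ineq73KernelLettersLatticeFree
import Literature.MathematicalPhysics.QuantumFieldTheory.Balaban1983to89.B11Ineq73KernelLettersUniform

/-!
# `Balaban1983to89.B11Ineq98W80LatticeFree` — T. Bałaban, *The variational problem and background fields in renormalization group method for lattice
gauge theories*, Commun. Math. Phys. **102** (1985) 277–309 [Balaban1985Variational], Proposition 4 (97)–(98) pp. 292–293 «The functional derivative of V(A′) is
an analytic function on this space, and satisfies the estimate |((δ/δA′)V)(A′)| < C₄ε₃²(Lʲη)⁻³ on Ω_j … The constants a₃, C₄ depend on d and L only. …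
|((δ/δA′)V)(A′)|₍₋₃₎ ≦ C₄(max{|A′|₍₋₁₎, |∇A′|₍₋₂₎})², (98)», with (73) p. 289, (86)–(89) p. 291: **PROPOSITION 4 FOR THE TYPED `W = (δ/δA′)V` (`W80`) WITH A
LATTICE-FREE `(C₄, R′)` ON PRINT's SMALL-FIELD CLASS** — `B11Eq98CurrentSlot.quadAnalytic_W80` at the chain's `H = H̃_{1,k}`, `C = C_k`, its kernel-column
binders `hΘE`, `hΘ3` DISCHARGED lattice-free by `B11Ineq73KernelLettersLatticeFree.exists_thetaE_theta3_latticeFree` (this generation), the remaining letters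
DISPLAYED as lattice-free numbers (`M_ρ, M_τ, M_J, M_Δ`, the V₀-group's `(C_V, R_V)`, the radius `R′`): the (L3) W-slot of the lattice-uniform `cur U` chart
(`Support/NE9CurChartTowerPiLatticeUniformClass`, which takes `Wq` with `(C₄, a₃)` BEFORE the lattice) can now be fed with the CONCRETE `W80` at constants
that do not depend on the height, the spacing or the period

statement-level skeleton of published theorems with citation tags; proofs where landed; nothing here is a claim about the Yang–Mills mass gap

CITATION HEADER (lean-in-tree rule).  Audit cell `pub-balaban`, sub-cell `t4`, BINDER row NE9; NE9 crux-team LEAF PROVER 01 (`b2b-balaban-t4-ne9-formalise-leaf-01`,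
gen 97; bears_on: R4/N22).  Composition BY NAME: `exists_thetaE_theta3_latticeFree`, `B11Eq98CurrentSlot.quadAnalytic_W80` (ne9-leaf-05's (E)),
`B11Eq44CLetterTower.prop4Hyp_Cck`, `B11Ineq73KernelLettersUniform.C4W_mono` ∕ `quadAnalytic_mono_const`.  Sources read through the audited headers of those files
(`paper:balaban1985-cmp102-variational-background` pp. 289–293).  Nothing of print's proof reproduced; no constant of print valued.

WHAT IS PROVED (sorry-free; proof lane — no `def`).  **`exists_quadAnalytic_W80_latticeFree`**: `∃ α₁ j₁ B δ` BEFORE (K81)'s binder block VERBATIM through `hQ`,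
then for every level profile ∕ carrier data, [4] Prop. 2's data of `C_k` with Prop. 5's radius `ρ′`, every Sect. C regime `Regime H̃_{1,k} 0 C_k b 0 (C2T d α₀) ρ′ 0 a_C ε_C`
with `0 < a_C`, `ε_C + a_C ≤ ρ′`, weight-ratio bound `ϖ`, the window `(ε_C + a_C)ΘΓ ≤ ½`, and the displayed W-slot letters (`0 ≤ C_V`, `0 < R_V`, `M_ρ, M_τ, M_J, M_Δ ≥ 0`,
`0 < R′ ≤ a_C`, `R′ ≤ (1 − 4bC₂(ε_C + a_C))R_V`, `‖ρ‖ ≤ M_ρ`, `‖τ‖ ≤ M_τ`, the V₀-slot at `(C_V, R_V)`, `‖J‖ ≤ M_J`, `‖Δ_π‖ ≤ M_Δ`):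
`QuadAnalytic (W80 ρ τ U₀ H̃_{1,k} C_k ε_C J Δ_π) C₄ R′ ∧ AnalyticOnNhd ℂ (W80 …) {‖Y‖ < R′}`, `C₄ = C4W M_ρ M_τ M_J M_Δ b (C2T d α₀) ℓ θ₃ θ_E C_V R′` with
`θ_E = 2ϖΘΓℓ`, `θ₃ = (2ℓ + 1)ϖΘΓ/a_C`, `Θ = M_φBM_φ′·d·K_d(δ)`, `Γ = C₃·2^d·2d`, `ℓ = (1 − 4bC₂(ε_C + a_C))⁻¹`.
HONEST SCOPE.  (i) The letters `M_J` (print's current window × the weight profile: `‖Jcur U₀‖ ≤ ω₃j₀` is a one-line `NegSup.norm_le_iff`), `M_Δ` ([5] (3.132) — per lattice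
unless fed by the (117)-type rows of `B9Eq3119DeltaPiTower`), `C_V` (`B11Eq98V0LettersLatticeUniform`), the fibre maps' norms and the regime's numerics stay
DISPLAYED; feeding the chart's `Wq` slot is the consumer's one-liner.  (ii) Constants crude; NOT print's `C₄(d, L)` valued.  (iii) NOT summit progress (cell pub-balaban:
NE9 NOT PRINTED ∕ NOT PROVED; «NE9 ⇐ the named binders»; row WALLED ON A MODEL (O-NE9-1; #5 UNRULED); spine PROVED 0∕9; rung (B)+1 on a finite T⁴ — NOT infinite
volume, NOT mass gap, NOT BetaPertH, NOT Clay; HONEST DEPENDENCY: continuum YM on T⁴ ⇐ BetaPertH ∧ nine spine estimates (0/9 proved); BetaPertH ⇐ (D1) ∧ (D4) ∧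
CAP+tail; G-an2-4 gates asym, D1 and NE2/3/4).  NEW file; imports `B11Ineq73KernelLettersLatticeFree`, `B11Ineq73KernelLettersUniform`; nothing modified.
Net new unproved facts: 0.
-/

noncomputable section

set_option autoImplicit false

open scoped InnerProductSpace ComplexConjugate BigOperators

namespace Literature.MathematicalPhysics.QuantumFieldTheory.Balaban1983to89.B11Ineq98W80LatticeFree

open B4Sect5Torus (TSite tdist tdist_nonneg tdist_symm tdist_self tdist_triangle torusSum_le)
open B4Sect5Proof (latticeConst latticeConst_nonneg)
open B9SectCLatticeCarrier (Bond DirPair bpos btgt shift unshift)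
open B9Eq311L2Pairing (WL2)
open B9Eq319QprimeTorus (fineP blockCoord)
open B7Prop1Explicit (U1 Wcx boxVec)
open B11Eq103H1Complex (SiteL2K BondL2K greenK covDerivL2K covDivL2K G1LatticeK KinvLatticeK H1LatticeK H1LatticeK_eq)
open B9Eq310DeltaPrime (plaqHolU)
open B9Eq310HessianOperator (adTransportW hessOp)
open B9Eq310HessianHermitian (adTransportW_adjoint)
open B9Eq315QTorus (perCfg cornerSite)
open B9Eq315QTower (towerP UlevOf)
open B9Eq316TowerFlatIsOneStep (towerP_eq_fineP_pow siteCast)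
open B9Eq326OperatorTower (QprimeTowerW QkW RofUk laplaceAk G1k)
open B9Eq324DeltaPrimeATower (laplacePrimeAk GpOfUk)
open B9Eq33CovDerivLocalLetterTower (tdist_bigBlock_bpos_btgt_le_one)
open B9Eq3117GaugeModeStencilLettersTower (local_hessOp_covDerivL2K_tower local_covDivL2K_hessOp_tower)
open B9Eq3130GtildePairRowsClosedTower (exists_local_letters_G1LatticeKPi)
open B9Eq3132QGtildeQInvLetterClosed (exists_local_letter_KinvLatticeKPi)
open B9Eq3119DeltaPiTower (piOfUk laplaceAkPi)

open B9Eq3126H1kPiSupRowClosed (exists_local_letter_H1LatticeKPi)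
open B9Eq326LocalPartTowerSupDecayDiagonalClosed (sum_bondMass_bigBlock_le)
open B11Eq103H1Complex (H1LatticeCLM H1CLM_apply funEquiv funEquiv_symm_apply)
open B11Eq115Space

open B9Eq3126H1kPiOneBlockColumn (exists_oneBlock_letter_H1LatticeCLM sum_fine_exp_block_le sum_fine_weight_exp_block_le)
open B11Eq103H1Complex (H1LatticeCLM)
open B11Eq115Space
open B11Prop6Scheme (Prop4Hyp)
open B11Eq174Chart (Regime)
open B11Eq90Transpose (kernel single115)
open B11Eq90V0primeCurrent (flat115 flat115_apply)
open B11Eq80Current (Emap E3)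
open B11Eq44COperatorTower (C2T)
open B11Eq44CLetterTower (Cck prop4Hyp_Cck)
open B11Eq44CKernelColumnTower (norm_fderiv_Cck_single_apply_le)
open B7Eq141TorusImagesCount (sum_images_kerQdd_le)
open B7Prop2Explicit (pdev AvgClosed C0 c2')
open B7Prop3Flat (c3)
open B7Prop5GeneralLevels (thetaGen C3Gen)
open B7Prop5GeneralOperators (kerQdd kerQdd_nonneg)
open B9Eq315QTorusOnto (liftSite periodVec)
open B11Eq73KernelColumnsCarrier (colSum_weighted_kernel_fderiv_Emap_le)
open B11Rem289KernelColumnsTheta3 (colSum_weighted_kernel_fderiv_E3_le)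

open B11Ineq73KernelLettersLatticeFree (exists_thetaE_theta3_latticeFree)
open B13Contraction113 (QuadAnalytic)
open B11Eq80Current (W80)
open B11Eq63V0GroupCurrent (curV0)
open B11Eq98CurrentSlot (C4W quadAnalytic_W80)
open B11Ineq73KernelLettersUniform (C4W_mono quadAnalytic_mono_const)
open Metric Set


variable {d : ℕ} (hd : 1 ≤ d) (L : ℕ) [NeZero L] (hL : 1 ≤ L) (hL3 : 3 ≤ L)
  {𝔸 : Type*} [NormedRing 𝔸] [NormedAlgebra ℂ 𝔸] [CompleteSpace 𝔸] [NormOneClass 𝔸] [StarRing 𝔸] [NormedStarGroup 𝔸] [StarModule ℂ 𝔸]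
  {W : Type*} [NormedAddCommGroup W] [InnerProductSpace ℂ W] [FiniteDimensional ℂ W] (φ : W ≃ₗ[ℂ] 𝔸)
  {Mφ Mφ' : ℝ} (hMφ : 0 ≤ Mφ) (hMφ' : 0 ≤ Mφ') (hφ : ∀ w, ‖φ w‖ ≤ Mφ * ‖w‖) (hφ' : ∀ X, ‖φ.symm X‖ ≤ Mφ' * ‖X‖) (hstar : ∀ X : 𝔸, ‖star X‖ ≤ ‖X‖)
  {a : ℝ} (ha : 0 < a) {a' : ℝ} (ha' : 0 < a') {ϱ : ℝ} (hϱ0 : 0 ≤ ϱ) (hϱ1 : ϱ < 1)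
  (τ : 𝔸 →ₗ[ℂ] ℂ) {Cτ : ℝ} (hτ : ∀ X, ‖τ X‖ ≤ Cτ * ‖X‖) (hCτ : 0 ≤ Cτ) {Mτ : ℝ} (hτm : ∀ X Y : 𝔸, ‖τ (X * Y)‖ ≤ Mτ * ‖X‖ * ‖Y‖) (hMτ : 0 ≤ Mτ)
  {ρw : ℝ} (hρw : 0 ≤ ρw)
  (hτ₁ : ∀ X : 𝔸, τ (star X) = conj (τ X)) (hτ₂ : ∀ X Y : 𝔸, τ (X * Y) = τ (Y * X)) (hφτ : ∀ X Y : 𝔸, ⟪φ.symm X, φ.symm Y⟫_ℂ = τ (star X * Y))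
  (AQ : ℝ)




set_option maxRecDepth 8192 in
set_option maxHeartbeats 1600000 in -- (K81)'s ≈ 50-binder block + the `C_k` block + the W-slot letters
include hd hL hL3 hMφ hMφ' hφ hφ' hstar ha ha' hϱ0 hϱ1 hτ hCτ hτm hMτ hρw hτ₁ hτ₂ hφτ in
/-- **PROPOSITION 4 FOR `W80` WITH A LATTICE-FREE `(C₄, R′)` ON PRINT's CLASS** («|((δ/δA′)V)(A′)|₍₋₃₎ ≦ C₄(max{{|A′|₍₋₁₎, |∇A′|₍₋₂₎}})², (98) … The constants
a₃, C₄ depend on d and L only»): for the chain's `H = H̃_{1,k}`, `C = C_k`, `∃ (α₁, j₁, B, δ)` BEFORE the lattice, then — under (K81)'s data of `H̃_{1,k}`, [4] Prop. 2's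
data of `C_k` with Prop. 5's radius `ρ′`, a Sect. C regime `Regime H 0 C b 0 C₂ ρ′ 0 a_C ε_C` with `ε_C + a_C ≤ ρ′`, the window `(ε_C + a_C)ΘΓ ≤ ½`, and the W-slot's
DISPLAYED letters (the V₀-group's slot `(C_V, R_V)`, the fibre maps' norms `M_ρ, M_τ`, the currents' norms `M_J, M_Δ`, a radius `0 < R′ ≤ a_C`,
`R′ ≤ (1 − 4bC₂(ε_C + a_C))R_V`) — BOTH W-slot clauses of the `cur U` chart: `QuadAnalytic (W80 …) C₄ R′ ∧ AnalyticOnNhd ℂ (W80 …) {{‖Y‖ < R′}}` with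
`C₄ = C4W M_ρ M_τ M_J M_Δ b C₂ ℓ θ₃ θ_E C_V R′`, `θ_E = 2ϖΘΓℓ`, `θ₃ = (2ℓ + 1)ϖΘΓ/a_C`, `Θ = M_φBM_φ′·d·K_d(δ)`, `Γ = C₃·2^d·2d` — every letter lattice-free
(`B11Eq98CurrentSlot.quadAnalytic_W80` fed by `exists_thetaE_theta3_latticeFree`, monotonicity `C4W_mono`).
[cite: Balaban1985Variational, Prop. 4 (97)–(98) pp.292–293, (73) p.289, (86)–(89) p.291; Balaban1985Averaging, Prop. 5 (157) p.42; Balaban1985BackgroundPropagators, (3.126) p.420, Thm 3.12 p.423] -/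
theorem exists_quadAnalytic_W80_latticeFree :
    ∃ α₁ j₁ B δ : ℝ, 0 < α₁ ∧ 0 < j₁ ∧ 0 ≤ B ∧ 0 < δ ∧
      ∀ (n : ℕ) (η : ℝ) (_hηL : η * (L : ℝ) ^ (n + 1) = 1) (c₀ c₁ : ℝ) [Fact (0 < c₀)] [Fact (0 < c₁)]
        (_hw : c₀ * ((L : ℝ) ^ (n + 1)) ^ d = c₁) (_hρ : |η| ^ d / c₀ ≤ ρw) (m : Fin d → ℕ) [∀ i, NeZero (m i)] (_hm : ∀ i, 1 ≤ m i)
        (U : Bond d (towerP L m (n + 1)) → 𝔸ˣ) (αU : ℕ → ℝ) (_hα0 : ∀ j, 0 ≤ αU j) (hα1 : ∀ j, αU j ≤ 1 / 64)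
        (hαL : ∀ j, 50 * (d + 1) * αU j * (L : ℝ) ^ d ≤ 1 / 2)
        (hU1 : ∀ (j : ℕ) (x : B7Prop1Explicit.Site d) (k : Fin d), perCfg (towerP L m (j + 1)) (UlevOf L m (n + 1) U j) x k ∈ U1 𝔸)
        (hreg : ∀ (j : ℕ) (y : TSite d (towerP L m j)) (k : Fin d) (ρ' : Fin d → Fin L),
          ‖((Wcx L (perCfg (towerP L m (j + 1)) (UlevOf L m (n + 1) U j)) (cornerSite L y) k (boxVec L ρ') : 𝔸ˣ) : 𝔸) - 1‖ ≤ αU j)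
        (εU : ℕ → ℝ) (_hεU : ∀ j, 0 ≤ εU j) (_hUε : ∀ (j : ℕ) (b : Bond d (towerP L m (j + 1))), ‖(UlevOf L m (n + 1) U j b : 𝔸) - 1‖ ≤ εU j)
        (_hLb : ∀ (j : ℕ) (b : Bond d (towerP L m (j + 1))), UlevOf L m (n + 1) U j b ∈ U1 𝔸)
        (α : ℝ) (_hα : 0 ≤ α) (_hαle : α ≤ α₁)
        (hUst : ∀ b, star (U b : 𝔸) = (((U b)⁻¹ : 𝔸ˣ) : 𝔸)) (_hUb : ∀ b, U b ∈ U1 𝔸) (_hUη : ∀ b, ‖(U b : 𝔸) - 1‖ ≤ α * η)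
        (_hpl : ∀ p : B9SectCLatticeCarrier.Plaq d (towerP L m (n + 1)), ‖(plaqHolU U p : 𝔸) - 1‖ ≤ α * η ^ 2)
        (_hUgrad : ∀ (x : TSite d (towerP L m (n + 1))) (μ : Fin d), ‖(U (x, μ) : 𝔸) - U (unshift μ x, μ)‖ ≤ α * η ^ 2)
        (_hRlev : ∀ (j : ℕ) (b : Bond d (towerP L m (j + 1))) (w : W), ‖adTransportW φ (UlevOf L m (n + 1) U j) b w‖ ≤ ‖w‖)
        (_hεg : ∀ j < n + 1, εU j ≤ α * ϱ ^ j) (_hAQ : ∑ j ∈ Finset.range (n + 1), αU j ≤ AQ)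
        (hpos' : ∀ x : SiteL2K ℂ d (towerP L m (n + 1)) c₀ W, x ≠ 0 → 0 < RCLike.re ⟪x, laplacePrimeAk L m n φ η U a' (c₁ := c₁) x⟫_ℂ)
        (hpos : ∀ x : BondL2K ℂ d (towerP L m (n + 1)) c₀ W, x ≠ 0 →
          0 < RCLike.re ⟪x, laplaceAk L m n φ η U hL αU hα1 hU1 hreg τ (c₀ := c₀) (c₁ := c₁) a x⟫_ℂ)
        (_hc₀η : c₀ = η ^ d) (j₀ : ℝ) (_hJ : ∀ μ y, ‖B9Eq39Adjoint.J (fun μ => B9Eq33CovDerivVector.shiftEquiv μ) (fun μ y => U (y, μ)) η μ y‖ ≤ j₀) (_hj : j₀ ≤ j₁)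
        (hposπ : ∀ x : BondL2K ℂ d (towerP L m (n + 1)) c₀ W, x ≠ 0 →
          0 < RCLike.re ⟪x, laplaceAkPi L m n φ τ η U a' hpos' hL αU hα1 hU1 hreg (c₁ := c₁) a x⟫_ℂ)
        (hQ : Function.Surjective (QkW L m n φ U hL αU hα1 hU1 hreg (c₀ := c₀) (c₁ := c₁)))
        [FiniteDimensional ℂ 𝔸] (lev₀ : Bond d (towerP L m (n + 1)) → ℕ) {κ' : Type*} [Fintype κ'] (lev₁ : κ' → ℕ)
        (Dc : (Bond d (towerP L m (n + 1)) → 𝔸) →ₗ[ℂ] (κ' → 𝔸)) (levB : Bond d m → ℕ) [Fact (0 < (L : ℝ))] [Fact (0 < η)]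
        -- the `C_k`-side data ([4] Prop. 2 on `U`, the levels, the radius `ρ′` of Prop. 5's regime)
        (hL2 : 2 ≤ L) {Gr : Subgroup 𝔸ˣ} (_hGr : AvgClosed d L Gr) (_hUG : ∀ (x : B7Prop1Explicit.Site d) (κ : Fin d), perCfg (towerP L m (n + 1)) U x κ ∈ Gr)
        {α₀ : ℝ} (_hα₀ : 0 < α₀) (_hα3 : C0 d * α₀ ≤ 1 / 3) (_hα4 : 4 * α₀ ≤ c2' d L)
        (_h52 : pdev (perCfg (towerP L m (n + 1)) U) < α₀ * (((L : ℝ) ^ (n + 1))⁻¹) ^ 2) (_hlev : ∀ b, n + 1 ≤ lev₀ b) {ρ' : ℝ}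
        (_hρ' : Real.exp (4 * (800 * ((d : ℝ) + 1) ^ 2 * ((d : ℝ) + 4)) * α₀) * (1 + 8 * (131072 * ((d : ℝ) + 1) ^ 2) * ρ') ≤ 2)
        (_hρ'4 : 4 * ρ' ≤ c3 d L) (_hθ : 2 * d * thetaGen d L α₀ ≤ (L : ℝ) ^ 3 / 16) (_hC3 : 2 * d * C3Gen d L * ρ' ≤ 1)
        -- the Sect. C regime of the pair `(H̃_{1,k}, C_k)` and the window of the kernel route
        {b aC εC : ℝ} (_RC : Regime (H1LatticeCLM (L := (L : ℝ)) (η := η) (lev₀ := lev₀) (levB := levB) φ hposπ hQ lev₁ Dc) 0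
          (Cck L m η (n + 1) U lev₀ lev₁ Dc levB) b 0 (C2T d α₀) ρ' 0 aC εC)
        (_haC : 0 < aC) (_hεa : εC + aC ≤ ρ') {ϖ : ℝ} (_hϖ0 : 0 ≤ ϖ)
        (_hϖ : ∀ bb b' : Bond d (towerP L m (n + 1)), levWeight (L : ℝ) η lev₀ 3 bb / levWeight (L : ℝ) η lev₀ 3 b' ≤ ϖ)
        (_hq : (εC + aC) * (Mφ * B * Mφ' * (d * latticeConst d δ)) * (C3Gen d L * (2 ^ d * (2 * d))) ≤ 1 / 2)
        -- the W-slot's displayed letters: the V₀-group's slot, the fibre maps, the currents, the radius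
        {CV RV Mρ Mτ MJ MΔ : ℝ} (_hCV : 0 ≤ CV) (_hRV : 0 < RV) (_hMρ : 0 ≤ Mρ) (_hMτ : 0 ≤ Mτ) (_hMJ : 0 ≤ MJ) (_hMΔ : 0 ≤ MΔ)
        {R' : ℝ} (_hR'0 : 0 < R') (_hR'a : R' ≤ aC) (_hR'V : R' ≤ (1 - 4 * b * C2T d α₀ * (εC + aC)) * RV)
        (ρ : (𝔸 →L[ℂ] ℂ) →L[ℂ] 𝔸) (τc : 𝔸 →L[ℂ] ℂ) (U₀ : Bond d (towerP L m (n + 1)) → 𝔸ˣ) (_hρ : ‖ρ‖ ≤ Mρ) (_hτc : ‖τc‖ ≤ Mτ)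
        (_hqV : ∀ Y : Space115 (L : ℝ) η lev₀ lev₁ Dc, ‖Y‖ < RV → ‖curV0 (lev₁ := lev₁) (Dc := Dc) ρ τc U₀ Y‖ ≤ CV * ‖Y‖ ^ 2)
        (J : NegSize (L : ℝ) η lev₀ 3 𝔸) (Δπ : Space115 (L : ℝ) η lev₀ lev₁ Dc →L[ℂ] NegSize (L : ℝ) η lev₀ 3 𝔸) (_hJ : ‖J‖ ≤ MJ) (_hΔ : ‖Δπ‖ ≤ MΔ),
        QuadAnalytic (W80 ρ τc U₀ (H1LatticeCLM (L := (L : ℝ)) (η := η) (lev₀ := lev₀) (levB := levB) φ hposπ hQ lev₁ Dc)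
            (Cck L m η (n + 1) U lev₀ lev₁ Dc levB) εC J Δπ)
          (C4W Mρ Mτ MJ MΔ b (C2T d α₀) (1 / (1 - 4 * b * C2T d α₀ * (εC + aC)))
            ((2 * (1 / (1 - 4 * b * C2T d α₀ * (εC + aC))) + 1) * (ϖ * (Mφ * B * Mφ' * (d * latticeConst d δ))) * (C3Gen d L * (2 ^ d * (2 * d))) / aC)
            (2 * (ϖ * (Mφ * B * Mφ' * (d * latticeConst d δ))) * (C3Gen d L * (2 ^ d * (2 * d))) * (1 / (1 - 4 * b * C2T d α₀ * (εC + aC)))) CV R') R' ∧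
        AnalyticOnNhd ℂ (W80 ρ τc U₀ (H1LatticeCLM (L := (L : ℝ)) (η := η) (lev₀ := lev₀) (levB := levB) φ hposπ hQ lev₁ Dc)
            (Cck L m η (n + 1) U lev₀ lev₁ Dc levB) εC J Δπ) {Y : Space115 (L : ℝ) η lev₀ lev₁ Dc | ‖Y‖ < R'} := by
  obtain ⟨α₁, j₁, B, δ, hα₁, hj₁, hB, hδ, HΘ⟩ :=
    exists_thetaE_theta3_latticeFree hd L hL hL3 φ hMφ hMφ' hφ hφ' hstar ha ha' hϱ0 hϱ1 τ hτ hCτ hτm hMτ hρw hτ₁ hτ₂ hφτ AQ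
  refine ⟨α₁, j₁, B, δ, hα₁, hj₁, hB, hδ, ?_⟩
  intro n η hηL c₀ c₁ _ _ hw hρ m _ hm U αU hα0 hα1 hαL hU1 hreg εU hεU hUε hLb α hα hαle hUst hUb hUη hpl hUgrad hRlev hεg hAQ hpos' hpos hc₀η j₀ hJ hj
    hposπ hQ _ lev₀ κ' _ lev₁ Dc levB _ _ hL2 Gr hGr hUG α₀ hα₀ hα3 hα4 h52 hlev ρ' hρ' hρ'4 hθ hC3 b aC εC RC haC hεa ϖ hϖ0 hϖ hq
    CV RV Mρ Mτ MJ MΔ hCV hRV hMρ hMτ hMJ hMΔ R' hR'0 hR'a hR'V ρ τc U₀ hρn hτn hqV J Δπ hJn hΔn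
  obtain ⟨hΘE, hΘ3⟩ := HΘ n η hηL c₀ c₁ hw hρ m hm U αU hα0 hα1 hαL hU1 hreg εU hεU hUε hLb α hα hαle hUst hUb hUη hpl hUgrad hRlev hεg hAQ hpos' hpos hc₀η j₀ hJ hj
    hposπ hQ lev₀ lev₁ Dc levB hL2 hGr hUG hα₀ hα3 hα4 h52 hlev hρ' hρ'4 hθ hC3 RC haC hεa hϖ0 hϖ hq
  have hK0 : 0 ≤ latticeConst d δ := latticeConst_nonneg d hδ.le
  have hC30 : 0 ≤ C3Gen d L := by unfold C3Gen B7Prop5GeneralLevels.C1ppGen; positivity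
  have h1q : 0 < 1 - 4 * b * C2T d α₀ * (εC + aC) := by linarith [RC.contr]
  have hθE : 0 ≤ (2 * (ϖ * (Mφ * B * Mφ' * (d * latticeConst d δ))) * (C3Gen d L * (2 ^ d * (2 * d))) * (1 / (1 - 4 * b * C2T d α₀ * (εC + aC)))) := by positivity
  have hθ₃ : 0 ≤ ((2 * (1 / (1 - 4 * b * C2T d α₀ * (εC + aC))) + 1) * (ϖ * (Mφ * B * Mφ' * (d * latticeConst d δ))) * (C3Gen d L * (2 ^ d * (2 * d))) / aC) := by positivity
  have hC : Prop4Hyp (Cck L m η (n + 1) U lev₀ lev₁ Dc levB) (C2T d α₀) ρ' :=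
    prop4Hyp_Cck L m η (n + 1) U lev₀ lev₁ Dc levB hL2 hGr hUG hα₀ hα3 hα4 h52 hlev hρ' (by linarith [RC.ε₄_nonneg])
  obtain ⟨hq98, han⟩ := quadAnalytic_W80 ρ τc U₀ hCV hqV RC hC J Δπ hθ₃ hθE hR'0.le hR'a hR'V
    (fun A' hA' bb => hΘE A' (lt_of_lt_of_le hA' hR'a) bb) (fun A' hA' bb => hΘ3 A' (lt_of_lt_of_le hA' hR'a) bb)
  refine ⟨quadAnalytic_mono_const hq98 ?_, han⟩
  exact C4W_mono (ContinuousLinearMap.opNorm_nonneg ρ) (ContinuousLinearMap.opNorm_nonneg τc) (norm_nonneg J) (ContinuousLinearMap.opNorm_nonneg Δπ)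
    RC.B₀_nonneg RC.C₄_nonneg hθ₃ hθE hCV hR'0.le hρn hτn hJn hΔn le_rfl le_rfl


end Literature.MathematicalPhysics.QuantumFieldTheory.Balaban1983to89.B11Ineq98W80LatticeFree

end
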